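import Summits.HubbardSuperconductivity.HubbardSuperconductivity.Theorems.MesoscopicPairOrder.Negative.StonerBound
import HarnessLib

/-!
# Crux `MesoscopicPairOrder` (stmt-HubbardSuperconductivity-7331), Negative side:
# the momentum SQUARE as a trial Fermi sea — `Σ_{square} ε_L ≤ -(4/π) m L sin(mπ/L)`

Line `redirect_birth` (lead c9); the lattice-sum input of the Stoner spin ceilings
(`StonerBound.eight_spin_le_of_pairedSea`, `StonerMoments.four_spin_le_of_pairedSea`: every duplicate-free
list `l` of `n` momenta gives `4S ≤ 4n + L² + 2Σ_l ε + U n`). A paired Fermi sea needs a CHEAP momentum set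
with LOW band energy; the `m × m` square `{-h, …, h}²`, `m = 2h + 1 ≤ L`, centred at `k = 0` has

  `Σ_{k ∈ square} ε_L(k) = -4 m · D_h`,  `D_h = Σ_{u=-h}^{h} cos(2πu/L) = sin(mπ/L) / sin(π/L) ≥ (L/π) sin(mπ/L)`

(Dirichlet kernel by telescoping `2 sin(θ/2) cos(uθ) = sin((u+½)θ) - sin((u-½)θ)`, then `sin(π/L) ≤ π/L`),
i.e. `≈ -(4/π) s sin(πs) L²` per unit area at side ratio `s = m/L` (`≈ -0.72 L²` per spin at `s² ≈ 0.4`,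
against the exact Fermi sea's `≈ -0.79 L²`). Proved here:

* `cos_two_pi_intCast_val_div` — `cos(2π·(z mod L)/L) = cos(2πz/L)` (reading momenta of `ℤ/Lℤ` as integers);
* `dirichlet_sum_lower` — `(L/π) sin((2h+1)π/L) ≤ Σ_{u < 2h+1} cos(2π(u - h)/L)` for `2h + 1 ≤ L`, `L ≥ 3`;
* `sum_torusBand_square_le` — the square's band energy is at most `-4(2h+1)(L/π) sin((2h+1)π/L)`;
* `exists_trialSet_card_eq` — for `(2h+1)² ≤ n ≤ L²`: a momentum set of EXACTLY `n` elements (square plus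
  `n - (2h+1)²` arbitrary momenta, each costing `≤ 4`) with band energy
  `≤ -(4/π)(2h+1) L sin((2h+1)π/L) + 4(n - (2h+1)²)`;
* `exists_odd_sq_le_lt` — every `n ≥ 1` sits in `[(2h+1)², (2h+3)²)` for some `h` (so the surplus is `≤ 8h + 8`).

Sources: E. M. Stein, R. Shakarchi, *Fourier Analysis* (2003), Ch. 2 §5 (Dirichlet kernel); E. C. Stoner,
Proc. R. Soc. A 165 (1938) 372. Folklore; no definition, no named fact.
-/

noncomputable section

-- the summit namespace repeats the problem name by design (D-0017)
set_option linter.dupNamespace false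

namespace Summit.HubbardSuperconductivity.HubbardSuperconductivity.Theorems.MesoscopicPairOrder.Negative

open Matrix Finset Filter
open Literature.Probability.LatticeModels Literature.MathematicalPhysics.QuantumLattice
open scoped ComplexOrder ComplexConjugate

section SquareSea

variable {L : ℕ} [NeZero L]

/-! ### Momenta as integers -/

/-- `cos(2π · (z mod L) / L) = cos(2π z / L)` for an integer `z` read in `ℤ/Lℤ` (the `val` representative
differs from `z` by a multiple of `L`). [folklore] -/
theorem cos_two_pi_intCast_val_div (z : ℤ) :
    Real.cos (2 * Real.pi * ((((z : ZMod L)).val : ℕ) : ℝ) / L) = Real.cos (2 * Real.pi * (z : ℝ) / L) := by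
  have hL0 : (L : ℝ) ≠ 0 := by exact_mod_cast (NeZero.ne L)
  have hval : ((((z : ZMod L)).val : ℕ) : ℤ) = z % (L : ℤ) := ZMod.val_intCast z
  have hreal : ((((z : ZMod L)).val : ℕ) : ℝ) = (z : ℝ) - (L : ℝ) * ((z / (L : ℤ) : ℤ) : ℝ) := by
    have h1 : ((((z : ZMod L)).val : ℕ) : ℝ) = (((((z : ZMod L)).val : ℕ) : ℤ) : ℝ) := by norm_cast
    rw [h1, hval, Int.emod_def]
    push_cast
    ring
  rw [hreal]
  have e : 2 * Real.pi * ((z : ℝ) - (L : ℝ) * ((z / (L : ℤ) : ℤ) : ℝ)) / L =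
      2 * Real.pi * (z : ℝ) / L - ((z / (L : ℤ) : ℤ) : ℝ) * (2 * Real.pi) := by
    field_simp
    try ring
  rw [e, Real.cos_sub_int_mul_two_pi]

/-! ### The Dirichlet sum by telescoping -/

/-- **Telescoped Dirichlet sum**: `2 sin(θ/2) · Σ_{u < m} cos((u - h)θ) = sin((m - h - ½)θ) - sin((-h - ½)θ)`
(`2 sin(θ/2) cos(xθ) = sin((x + ½)θ) - sin((x - ½)θ)`). Stein–Shakarchi Ch. 2 §5. [folklore] -/
theorem two_sin_mul_sum_cos (θ : ℝ) (h m : ℕ) :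
    2 * Real.sin (θ / 2) * ∑ u ∈ Finset.range m, Real.cos (((u : ℝ) - h) * θ) =
      Real.sin (((m : ℝ) - h - 1 / 2) * θ) - Real.sin ((-(h : ℝ) - 1 / 2) * θ) := by
  have key : ∀ u : ℕ, 2 * Real.sin (θ / 2) * Real.cos (((u : ℝ) - h) * θ) =
      Real.sin ((((u + 1 : ℕ) : ℝ) - h - 1 / 2) * θ) - Real.sin ((((u : ℕ) : ℝ) - h - 1 / 2) * θ) := by
    intro u
    rw [Real.sin_sub_sin]
    push_cast
    have e1 : ((((u : ℝ) + 1 - h - 1 / 2) * θ - ((u : ℝ) - h - 1 / 2) * θ) / 2) = θ / 2 := by ring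
    have e2 : ((((u : ℝ) + 1 - h - 1 / 2) * θ + ((u : ℝ) - h - 1 / 2) * θ) / 2) = ((u : ℝ) - h) * θ := by ring
    rw [e1, e2]
  rw [Finset.mul_sum]
  simp_rw [key]
  rw [Finset.sum_range_sub (fun u : ℕ => Real.sin ((((u : ℕ) : ℝ) - h - 1 / 2) * θ)) m]
  try push_cast
  try ring_nf

omit [NeZero L] in
/-- **Lower bound on the centred Dirichlet sum**: for `L ≥ 3` and `2h + 1 ≤ L`,
`(L/π) · sin((2h+1)π/L) ≤ Σ_{u < 2h+1} cos(2π(u - h)/L)`. Indeed the sum equals `sin((2h+1)π/L)/sin(π/L)`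
with `0 < sin(π/L) ≤ π/L` and `sin((2h+1)π/L) ≥ 0`. [folklore] -/
theorem dirichlet_sum_lower (hL : 3 ≤ L) (h : ℕ) (hm : 2 * h + 1 ≤ L) :
    (L : ℝ) / Real.pi * Real.sin ((2 * h + 1 : ℕ) * Real.pi / L) ≤
      ∑ u ∈ Finset.range (2 * h + 1), Real.cos (2 * Real.pi * ((u : ℝ) - h) / L) := by
  have hLpos : (0 : ℝ) < L := by exact_mod_cast (show 0 < L by omega)
  have hπ := Real.pi_pos
  set θ : ℝ := 2 * Real.pi / L with hθ
  have hθpos : 0 < θ := by rw [hθ]; positivity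
  -- rewrite the summand as `cos((u - h) θ)`
  have hsum : ∑ u ∈ Finset.range (2 * h + 1), Real.cos (2 * Real.pi * ((u : ℝ) - h) / L) =
      ∑ u ∈ Finset.range (2 * h + 1), Real.cos (((u : ℝ) - h) * θ) := by
    refine Finset.sum_congr rfl fun u _ => ?_
    rw [hθ]
    congr 1
    ring
  rw [hsum]
  set C : ℝ := ∑ u ∈ Finset.range (2 * h + 1), Real.cos (((u : ℝ) - h) * θ) with hC
  -- telescoping: `2 sin(θ/2) C = 2 sin((h + 1/2) θ)`
  have htel := two_sin_mul_sum_cos θ h (2 * h + 1)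
  have e1 : (((2 * h + 1 : ℕ) : ℝ) - h - 1 / 2) * θ = ((h : ℝ) + 1 / 2) * θ := by push_cast; ring
  have e2 : (-(h : ℝ) - 1 / 2) * θ = -(((h : ℝ) + 1 / 2) * θ) := by ring
  rw [e1, e2, Real.sin_neg, sub_neg_eq_add, ← two_mul] at htel
  -- `(h + 1/2) θ = (2h+1) π / L`
  have e3 : ((h : ℝ) + 1 / 2) * θ = (2 * h + 1 : ℕ) * Real.pi / L := by
    rw [hθ]; push_cast; field_simp
  rw [e3] at htel
  -- signs: `0 < sin(θ/2) ≤ θ/2`, `0 ≤ sin((2h+1)π/L)`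
  have hθ2 : θ / 2 = Real.pi / L := by rw [hθ]; ring
  have hsinpos : 0 < Real.sin (θ / 2) := by
    rw [hθ2]
    apply Real.sin_pos_of_pos_of_lt_pi (by positivity)
    rw [div_lt_iff₀ hLpos]
    have : (3 : ℝ) ≤ L := by exact_mod_cast hL
    nlinarith
  have hsinle : Real.sin (θ / 2) ≤ θ / 2 := Real.sin_le (by positivity)
  have hnonneg : 0 ≤ Real.sin ((2 * h + 1 : ℕ) * Real.pi / L) := by
    apply Real.sin_nonneg_of_nonneg_of_le_pi (by positivity)
    rw [div_le_iff₀ hLpos]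
    have : ((2 * h + 1 : ℕ) : ℝ) ≤ L := by exact_mod_cast hm
    nlinarith
  -- `C = sin(..)/sin(θ/2) ≥ sin(..)/(θ/2) = (L/π) sin(..)`
  have hCeq : C = Real.sin ((2 * h + 1 : ℕ) * Real.pi / L) / Real.sin (θ / 2) := by
    rw [eq_div_iff hsinpos.ne']
    linarith
  rw [hCeq]
  have hLπ : (L : ℝ) / Real.pi = 1 / (θ / 2) := by rw [hθ2]; field_simp
  rw [hLπ, one_div, ← div_eq_inv_mul]
  exact div_le_div_of_nonneg_left hnonneg hsinpos hsinle

/-! ### The momentum square -/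

/-- Sums over a two-coordinate index factor through the product. [folklore] -/
theorem sum_fin_two_pi {α β : Type*} [Fintype α] [AddCommMonoid β] (f : α → α → β) :
    ∑ k : Fin 2 → α, f (k 0) (k 1) = ∑ a : α, ∑ b : α, f a b := by
  rw [← Fintype.sum_prod_type']
  exact Fintype.sum_equiv (piFinTwoEquiv fun _ => α) _ _ fun k => rfl

/-- **Band energy of the momentum square**: for `L ≥ 3` and `2h + 1 ≤ L`, the points
`k_v = (v₀ - h, v₁ - h) ∈ (ℤ/Lℤ)²`, `v ∈ [0, 2h+1)²`, have
`Σ_v ε_L(k_v) ≤ -4 (2h+1) (L/π) sin((2h+1)π/L)` (`= -4 (2h+1) D_h` exactly). [folklore] -/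
theorem sum_torusBand_square_le (hL : 3 ≤ L) (h : ℕ) (hm : 2 * h + 1 ≤ L) :
    ∑ v : Fin 2 → Fin (2 * h + 1),
        torusBand L (fun i => (((v i : ℕ) : ZMod L)) - ((h : ℕ) : ZMod L)) ≤
      -4 * ((2 * h + 1 : ℕ) : ℝ) * ((L : ℝ) / Real.pi * Real.sin ((2 * h + 1 : ℕ) * Real.pi / L)) := by
  -- the band at a square point, as integer cosines
  have hpt : ∀ (v : Fin 2 → Fin (2 * h + 1)) (i : Fin 2),
      Real.cos (latticeMomentum L (fun i => (((v i : ℕ) : ZMod L)) - ((h : ℕ) : ZMod L)) i) =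
        Real.cos (2 * Real.pi * (((v i : ℕ) : ℝ) - h) / L) := by
    intro v i
    rw [latticeMomentum_apply]
    have e : ((((v i : ℕ) : ZMod L)) - ((h : ℕ) : ZMod L)) = ((((v i : ℕ) : ℤ) - (h : ℤ) : ℤ) : ZMod L) := by
      push_cast; ring
    rw [e, cos_two_pi_intCast_val_div]
    push_cast
    ring_nf
  have hband : ∀ v : Fin 2 → Fin (2 * h + 1),
      torusBand L (fun i => (((v i : ℕ) : ZMod L)) - ((h : ℕ) : ZMod L)) =
        -2 * (Real.cos (2 * Real.pi * (((v 0 : ℕ) : ℝ) - h) / L) +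
          Real.cos (2 * Real.pi * (((v 1 : ℕ) : ℝ) - h) / L)) := by
    intro v
    unfold torusBand
    rw [Fin.sum_univ_two, hpt v 0, hpt v 1]
  simp_rw [hband]
  rw [← Finset.mul_sum, Finset.sum_add_distrib]
  -- each coordinate sum is `(2h+1) · C`
  set c : Fin (2 * h + 1) → ℝ := fun u => Real.cos (2 * Real.pi * (((u : ℕ) : ℝ) - h) / L) with hc
  have h0 : ∑ v : Fin 2 → Fin (2 * h + 1), Real.cos (2 * Real.pi * (((v 0 : ℕ) : ℝ) - h) / L) =
      ((2 * h + 1 : ℕ) : ℝ) * ∑ u : Fin (2 * h + 1), c u := by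
    rw [show (∑ v : Fin 2 → Fin (2 * h + 1), Real.cos (2 * Real.pi * (((v 0 : ℕ) : ℝ) - h) / L)) =
        ∑ a : Fin (2 * h + 1), ∑ _b : Fin (2 * h + 1), c a from sum_fin_two_pi (fun a _ => c a)]
    simp only [Finset.sum_const, Finset.card_univ, Fintype.card_fin, nsmul_eq_mul]
    rw [Finset.mul_sum]
  have h1 : ∑ v : Fin 2 → Fin (2 * h + 1), Real.cos (2 * Real.pi * (((v 1 : ℕ) : ℝ) - h) / L) =
      ((2 * h + 1 : ℕ) : ℝ) * ∑ u : Fin (2 * h + 1), c u := by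
    rw [show (∑ v : Fin 2 → Fin (2 * h + 1), Real.cos (2 * Real.pi * (((v 1 : ℕ) : ℝ) - h) / L)) =
        ∑ _a : Fin (2 * h + 1), ∑ b : Fin (2 * h + 1), c b from sum_fin_two_pi (fun _ b => c b)]
    simp only [Finset.sum_const, Finset.card_univ, Fintype.card_fin, nsmul_eq_mul]
  -- the one-dimensional sum is the Dirichlet sum over `range (2h+1)`
  have hC : ∑ u : Fin (2 * h + 1), c u =
      ∑ u ∈ Finset.range (2 * h + 1), Real.cos (2 * Real.pi * ((u : ℝ) - h) / L) := by
    rw [hc, Fin.sum_univ_eq_sum_range (fun u : ℕ => Real.cos (2 * Real.pi * ((u : ℝ) - h) / L))]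
  have hD := dirichlet_sum_lower hL h hm
  rw [h0, h1, hC]
  have hmpos : (0 : ℝ) ≤ ((2 * h + 1 : ℕ) : ℝ) := by positivity
  nlinarith [mul_le_mul_of_nonneg_left hD hmpos]

omit [NeZero L] in
/-- The square's parametrisation is injective when `2h + 1 ≤ L` (distinct residues). [folklore] -/
theorem square_injective (h : ℕ) (hm : 2 * h + 1 ≤ L) :
    Function.Injective (fun v : Fin 2 → Fin (2 * h + 1) =>
      (fun i => (((v i : ℕ) : ZMod L)) - ((h : ℕ) : ZMod L) : TorusSite 2 L)) := by
  intro v w hvw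
  funext i
  have hi := congrFun hvw i
  simp only [sub_left_inj] at hi
  have hv : (v i : ℕ) < L := lt_of_lt_of_le (v i).isLt hm
  have hw : (w i : ℕ) < L := lt_of_lt_of_le (w i).isLt hm
  have := (ZMod.natCast_eq_natCast_iff' (v i : ℕ) (w i : ℕ) L).1 hi
  rw [Nat.mod_eq_of_lt hv, Nat.mod_eq_of_lt hw] at this
  exact Fin.ext this

/-- **A trial momentum set of exactly `n` elements.** For `L ≥ 3`, `2h + 1 ≤ L` and `(2h+1)² ≤ n ≤ L²` there
is `T ⊆ (ℤ/Lℤ)²` with `|T| = n` and `Σ_{k∈T} ε_L(k) ≤ -(4/π)(2h+1) L sin((2h+1)π/L) + 4(n - (2h+1)²)`: the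
momentum square plus `n - (2h+1)²` further momenta, each of band energy `≤ 4`. [folklore] -/
theorem exists_trialSet_card_eq (hL : 3 ≤ L) (h : ℕ) (hm : 2 * h + 1 ≤ L) {n : ℕ}
    (hn : (2 * h + 1) ^ 2 ≤ n) (hnL : n ≤ L ^ 2) :
    ∃ T : Finset (TorusSite 2 L), T.card = n ∧
      ∑ k ∈ T, torusBand L k ≤
        -4 * ((2 * h + 1 : ℕ) : ℝ) * ((L : ℝ) / Real.pi * Real.sin ((2 * h + 1 : ℕ) * Real.pi / L)) +
          4 * ((n - (2 * h + 1) ^ 2 : ℕ) : ℝ) := by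
  classical
  set pt : (Fin 2 → Fin (2 * h + 1)) → TorusSite 2 L :=
    fun v => fun i => (((v i : ℕ) : ZMod L)) - ((h : ℕ) : ZMod L) with hpt
  have hinj : Function.Injective pt := square_injective h hm
  set Sq : Finset (TorusSite 2 L) := Finset.univ.image pt with hSq
  have hSqcard : Sq.card = (2 * h + 1) ^ 2 := by
    rw [hSq, Finset.card_image_of_injective _ hinj, Finset.card_univ, Fintype.card_fun, Fintype.card_fin,
      Fintype.card_fin]
  have hSqsum : ∑ k ∈ Sq, torusBand L k ≤
      -4 * ((2 * h + 1 : ℕ) : ℝ) * ((L : ℝ) / Real.pi * Real.sin ((2 * h + 1 : ℕ) * Real.pi / L)) := by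
    rw [hSq, Finset.sum_image fun v _ w _ hvw => hinj hvw]
    exact sum_torusBand_square_le hL h hm
  -- the complement has enough room for the surplus
  have huniv : (Finset.univ : Finset (TorusSite 2 L)).card = L ^ 2 := by
    simp [Finset.card_univ, Fintype.card_pi, ZMod.card]
  have hroom : n - (2 * h + 1) ^ 2 ≤ (Finset.univ \ Sq).card := by
    rw [Finset.card_sdiff_of_subset (Finset.subset_univ _), huniv, hSqcard]
    omega
  obtain ⟨X, hXsub, hXcard⟩ := Finset.exists_subset_card_eq hroom
  have hdisj : Disjoint Sq X := by
    rw [Finset.disjoint_iff_ne]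
    rintro a ha b hb rfl
    exact (Finset.mem_sdiff.1 (hXsub hb)).2 ha
  refine ⟨Sq ∪ X, ?_, ?_⟩
  · rw [Finset.card_union_of_disjoint hdisj, hSqcard, hXcard]
    omega
  · rw [Finset.sum_union hdisj]
    have hX : ∑ k ∈ X, torusBand L k ≤ 4 * ((n - (2 * h + 1) ^ 2 : ℕ) : ℝ) := by
      calc ∑ k ∈ X, torusBand L k ≤ ∑ _k ∈ X, (4 : ℝ) := Finset.sum_le_sum fun k _ => torusBand_le_four L k
        _ = 4 * ((n - (2 * h + 1) ^ 2 : ℕ) : ℝ) := by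
            rw [Finset.sum_const, hXcard, nsmul_eq_mul]
            ring
    linarith

/-- Every `n ≥ 1` lies in `[(2h+1)², (2h+3)²)` for some `h` (take `2h + 1` = the largest odd number `≤ √n`). [folklore] -/
theorem exists_odd_sq_le_lt {n : ℕ} (hn : 1 ≤ n) : ∃ h : ℕ, (2 * h + 1) ^ 2 ≤ n ∧ n < (2 * h + 3) ^ 2 := by
  set q := Nat.sqrt n with hq
  have hq1 : 1 ≤ q := by
    rw [hq, Nat.le_sqrt]
    exact hn
  have hlo : q * q ≤ n := Nat.sqrt_le n
  have hhi : n < (q + 1) * (q + 1) := Nat.lt_succ_sqrt n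
  refine ⟨(q - 1) / 2, ?_, ?_⟩
  · have h1 : 2 * ((q - 1) / 2) + 1 ≤ q := by omega
    calc (2 * ((q - 1) / 2) + 1) ^ 2 ≤ q ^ 2 := Nat.pow_le_pow_left h1 2
      _ = q * q := by ring
      _ ≤ n := hlo
  · have h2 : q + 1 ≤ 2 * ((q - 1) / 2) + 3 := by omega
    calc n < (q + 1) * (q + 1) := hhi
      _ = (q + 1) ^ 2 := by ring
      _ ≤ (2 * ((q - 1) / 2) + 3) ^ 2 := Nat.pow_le_pow_left h2 2

/-- Registered sub-goal form (line `redirect_birth`, lead c9): the `n`-element trial momentum set built on the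
centred square, all parameters explicit (`exists_trialSet_card_eq`). [folklore] -/
theorem existsTrialSetCardEq : ∀ {L : ℕ} [NeZero L], 3 ≤ L → ∀ (h : ℕ), 2 * h + 1 ≤ L → ∀ {n : ℕ}, (2 * h + 1) ^ 2 ≤ n → n ≤ L ^ 2 → ∃ T : Finset (TorusSite 2 L), T.card = n ∧ ∑ k ∈ T, torusBand L k ≤ -4 * ((2 * h + 1 : ℕ) : ℝ) * ((L : ℝ) / Real.pi * Real.sin ((2 * h + 1 : ℕ) * Real.pi / L)) + 4 * ((n - (2 * h + 1) ^ 2 : ℕ) : ℝ) :=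
  fun hL h hm _ hn hnL => exists_trialSet_card_eq hL h hm hn hnL

end SquareSea

end Summit.HubbardSuperconductivity.HubbardSuperconductivity.Theorems.MesoscopicPairOrder.Negative
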